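import Summits.QuantumFields.QCD.Theorems.PauliWegnerSeaFMClosureUnquenchedSplitC3

namespace SplitScratchDefeq

open scoped BigOperators Topology Manifold Classical MeasureTheory ProbabilityTheory Matrix InnerProductSpace ComplexConjugate ContinuousMap
open Filter Set Function TopologicalSpace MeasureTheory

def TwoStarPackage : Prop :=
  open MeasureTheory Filter Literature.MathematicalPhysics.QuantumFieldTheory Literature.MathematicalPhysics.QuantumLattice Literature.Probability.LatticeModels in ∀ Nf : ℕ, ∃ s₀ C p : ℝ, 0 < s₀ ∧ s₀ < 1 ∧ 0 < C ∧ ∀ s : ℝ, 0 < s → s ≤ s₀ → ∀ (β : ℝ) (mq : Fin Nf → ℝ) (f : Fin Nf), -9 ≤ mq f → mq f ≤ 1 → ∀ (S : ℕ), let bn : Matrix (TorusSite 4 (2 * S + 1) × Fin 3 × Fin 4) (TorusSite 4 (2 * S + 1) × Fin 3 × Fin 4) ℂ → TorusSite 4 (2 * S + 1) → TorusSite 4 (2 * S + 1) → ℝ := fun M x y => ∑ a : Fin 3, ∑ i : Fin 4, ∑ b : Fin 3, ∑ j : Fin 4, ‖M (x, a, i) (y, b, j)‖; let side : Finset (TorusSite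 4 (2 * S + 1)) → Matrix (TorusSite 4 (2 * S + 1) × Fin 3 × Fin 4) (TorusSite 4 (2 * S + 1) × Fin 3 × Fin 4) ℂ → Matrix (TorusSite 4 (2 * S + 1) × Fin 3 × Fin 4) (TorusSite 4 (2 * S + 1) × Fin 3 × Fin 4) ℂ := fun A M => Matrix.of fun p q => if p.1 ∈ A ∧ q.1 ∈ A then M p q else if p = q then 1 else 0; let gs : Finset (TorusSite 4 (2 * S + 1)) → Matrix (TorusSite 4 (2 * S + 1) × Fin 3 × Fin 4) (TorusSite 4 (2 * S + 1) × Fin 3 × Fin 4) ℂ → Matrix (TorusSite 4 (2 * S + 1) × Fin 3 × Fin 4) (TorusSite 4 (2 * S + 1) × Fin 3 × Fin 4) ℂ := fun A M => (side A M)⁻¹; let ebox : TorusSite 4 (2 * S + 1) → ℕ → Finset (TorusSite 4 (2 * S + 1)) := fun x r => (Fintype.piFinset fun _ : Fin 4 => Finset.Icc (-(r : ℤ) - 1) r).image fun w => x + Torus.proj (2 * S + 1) w; let wD : GaugeConfig 4 (2 * S + 1) (Matrix.specialUnitaryGroup (Fin 3) ℂ) → ℝ → Matrix (TorusSite 4 (2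 * S + 1) × Fin 3 × Fin 4) (TorusSite 4 (2 * S + 1) × Fin 3 × Fin 4) ℂ := fun U m₀ => wilsonDirac (fundamentalRep (Fin 3)) U m₀ 1; let pq : (GaugeConfig 4 (2 * S + 1) (Matrix.specialUnitaryGroup (Fin 3) ℂ) → ℝ) → ℝ := fun F => (∫ U : GaugeConfig 4 (2 * S + 1) (Matrix.specialUnitaryGroup (Fin 3) ℂ), ‖(diracMatrix U mq).det‖ * F U ∂(wilsonMeasure (fundamentalRep (Fin 3)) β)) / (∫ U : GaugeConfig 4 (2 * S + 1) (Matrix.specialUnitaryGroup (Fin 3) ℂ), ‖(diracMatrix U mq).det‖ ∂(wilsonMeasure (fundamentalRep (Fin 3)) β)); let ball : TorusSite 4 (2 * S + 1) → ℕ → Finset (TorusSite 4 (2 * S + 1)) := fun x r => (box 4 r).image fun w => x + Torus.proj (2 * S + 1) w; let adm : Finset (TorusSite 4 (2 * S + 1)) → Prop := fun A => A = Finset.univ ∨ ∃ (x : TorusSite 4 (2 * S + 1)) (r : ℕ), 1 ≤ r ∧ r + 1 ≤ S ∧ (A = ebox x r ∨ A = (ebox x r)ᶜ ∨ A = (ball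 x r)ᶜ); (0 < ∫ U : GaugeConfig 4 (2 * S + 1) (Matrix.specialUnitaryGroup (Fin 3) ℂ), ‖(diracMatrix U mq).det‖ ∂(wilsonMeasure (fundamentalRep (Fin 3)) β)) ∧ (∀ (s₁ s₂ s₃ : ℝ), 0 ≤ s₁ → s₁ ≤ s₀ → 0 ≤ s₂ → s₂ ≤ s₀ → 0 ≤ s₃ → s₃ ≤ s₀ → ∀ (A₁ A₂ A₃ : Finset (TorusSite 4 (2 * S + 1))), adm A₁ → adm A₂ → adm A₃ → ∀ (a₁ b₁ a₂ b₂ a₃ b₃ : TorusSite 4 (2 * S + 1)), Integrable (fun U : GaugeConfig 4 (2 * S + 1) (Matrix.specialUnitaryGroup (Fin 3) ℂ) => ‖(diracMatrix U mq).det‖ * (bn (gs A₁ (wD U (mq f))) a₁ b₁ ^ s₁ * bn (gs A₂ (wD U (mq f))) a₂ b₂ ^ s₂ * bn (gs A₃ (wD U (mq f))) a₃ b₃ ^ s₃)) (wilsonMeasure (fundamentalRep (Fin 3)) β)) ∧ (∀ (A : Finset (TorusSite 4 (2 * S + 1))), adm A → ∀ᵐ U ∂(wilsonMeasure (fundamentalRep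 (Fin 3)) β), (side A (wD U (mq f))).det ≠ 0) ∧ (∀ x y : TorusSite 4 (2 * S + 1), pq (fun U => bn (wD U (mq f))⁻¹ x y ^ s) ≤ C * (1 + |β|) ^ p) ∧ (∀ (x : TorusSite 4 (2 * S + 1)) (r : ℕ), 1 ≤ r → r + 1 ≤ S → ∀ (A : Finset (TorusSite 4 (2 * S + 1))), (A = ebox x r ∨ A = (ebox x r)ᶜ ∨ A = (ball x r)ᶜ) → ∀ a b c d : TorusSite 4 (2 * S + 1), a ∈ A → b ∈ A → pq (fun U => bn (gs A (wD U (mq f))) a b ^ s * bn (wD U (mq f))⁻¹ c d ^ s) ≤ C * (1 + |β|) ^ p * (1 + (r : ℝ)) ^ p * pq (fun U => bn (wD U (mq f))⁻¹ c d ^ s)) ∧ (∀ (x : TorusSite 4 (2 * S + 1)) (ℓ : ℕ), 1 ≤ ℓ → 3 * ℓ + 4 ≤ S → ∀ u u' v v' y : TorusSite 4 (2 * S + 1), u' ∈ ebox x (3 * ℓ + 2) → u' ∉ ebox x ℓ → v ∈ ebox x (3 * ℓ + 2) → v ∉ ebox x ℓ → v' ∉ ebox x (3 * ℓ + 2) →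 y ∉ ebox x (3 * ℓ + 2) → pq (fun U => bn (gs (ebox x ℓ) (wD U (mq f))) x u ^ s * bn (wD U (mq f))⁻¹ u' v ^ s * bn (gs (ebox x (3 * ℓ + 2))ᶜ (wD U (mq f))) v' y ^ s) ≤ C * (1 + |β|) ^ p * (1 + (ℓ : ℝ)) ^ p * pq (fun U => bn (gs (ebox x ℓ) (wD U (mq f))) x u ^ s * bn (gs (ebox x (3 * ℓ + 2))ᶜ (wD U (mq f))) v' y ^ s))

def FarCollarStability : Prop :=
  open MeasureTheory Filter Literature.MathematicalPhysics.QuantumFieldTheory Literature.MathematicalPhysics.QuantumLattice Literature.Probability.LatticeModels in ∀ Nf : ℕ, ∃ s₀ C p θ : ℝ, 0 < s₀ ∧ s₀ < 1 ∧ 0 < C ∧ 0 < θ ∧ θ ≤ 1 ∧ ∀ s : ℝ, 0 < s → s ≤ s₀ → ∀ (β : ℝ) (mq : Fin Nf → ℝ) (f : Fin Nf), -9 ≤ mq f → mq f ≤ 1 → ∀ (S : ℕ), let bn : Matrix (TorusSite 4 (2 * S + 1) × Fin 3 × Fin 4) (TorusSite 4 (2 * S + 1) × Fin 3 × Fin 4)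 ℂ → TorusSite 4 (2 * S + 1) → TorusSite 4 (2 * S + 1) → ℝ := fun M x y => ∑ a : Fin 3, ∑ i : Fin 4, ∑ b : Fin 3, ∑ j : Fin 4, ‖M (x, a, i) (y, b, j)‖; let side : Finset (TorusSite 4 (2 * S + 1)) → Matrix (TorusSite 4 (2 * S + 1) × Fin 3 × Fin 4) (TorusSite 4 (2 * S + 1) × Fin 3 × Fin 4) ℂ → Matrix (TorusSite 4 (2 * S + 1) × Fin 3 × Fin 4) (TorusSite 4 (2 * S + 1) × Fin 3 × Fin 4) ℂ := fun A M => Matrix.of fun p q => if p.1 ∈ A ∧ q.1 ∈ A then M p q else if p = q then 1 else 0; let gs : Finset (TorusSite 4 (2 * S + 1)) → Matrix (TorusSite 4 (2 * S + 1) × Fin 3 × Fin 4) (TorusSite 4 (2 * S + 1) × Fin 3 × Fin 4) ℂ → Matrix (TorusSite 4 (2 * S + 1) × Fin 3 × Fin 4) (TorusSite 4 (2 * S + 1) × Fin 3 × Fin 4) ℂ := fun A M => (side A M)⁻¹; let ebox : TorusSite 4 (2 * S + 1) → ℕ → Finset (TorusSite 4 (2 * S + 1)) := fun x r => (Fintype.piFinset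 fun _ : Fin 4 => Finset.Icc (-(r : ℤ) - 1) r).image fun w => x + Torus.proj (2 * S + 1) w; let wD : GaugeConfig 4 (2 * S + 1) (Matrix.specialUnitaryGroup (Fin 3) ℂ) → ℝ → Matrix (TorusSite 4 (2 * S + 1) × Fin 3 × Fin 4) (TorusSite 4 (2 * S + 1) × Fin 3 × Fin 4) ℂ := fun U m₀ => wilsonDirac (fundamentalRep (Fin 3)) U m₀ 1; let pq : (GaugeConfig 4 (2 * S + 1) (Matrix.specialUnitaryGroup (Fin 3) ℂ) → ℝ) → ℝ := fun F => (∫ U : GaugeConfig 4 (2 * S + 1) (Matrix.specialUnitaryGroup (Fin 3) ℂ), ‖(diracMatrix U mq).det‖ * F U ∂(wilsonMeasure (fundamentalRep (Fin 3)) β)) / (∫ U : GaugeConfig 4 (2 * S + 1) (Matrix.specialUnitaryGroup (Fin 3) ℂ), ‖(diracMatrix U mq).det‖ ∂(wilsonMeasure (fundamentalRep (Fin 3)) β)); ∀ (x : TorusSite 4 (2 * S + 1)) (ℓ : ℕ), 1 ≤ ℓ → 3 * ℓ + 4 ≤ S → ∀ u v' y : TorusSite 4 (2 * S + 1), u ∈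 ebox x ℓ → v' ∉ ebox x (3 * ℓ + 2) → y ∉ ebox x (3 * ℓ + 2) → pq (fun U => bn (gs (ebox x ℓ) (wD U (mq f))) x u ^ s * bn (gs (ebox x (3 * ℓ + 2))ᶜ (wD U (mq f))) v' y ^ s) ≤ C * (1 + |β|) ^ p * (1 + (ℓ : ℝ)) ^ p * (pq (fun U => bn (gs (ebox x ℓ) (wD U (mq f))) x u ^ s) ^ θ + pq (fun U => bn (gs (ebox x ℓ) (wD U (mq f))) x u ^ s)) * pq (fun U => bn (gs (ebox x (3 * ℓ + 2))ᶜ (wD U (mq f))) v' y ^ s)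

def InwardCore : Prop :=
  open MeasureTheory Filter Literature.MathematicalPhysics.QuantumFieldTheory Literature.MathematicalPhysics.QuantumLattice Literature.Probability.LatticeModels in ∀ (Nf : ℕ) (reg : QCDRegularisation Nf) (m : Fin Nf → ℝ), (∀ f, 0 < m f) → (∀ q : ℕ, ∃ K₀ s : ℝ, 0 < s ∧ s < 1 ∧ ∀ᶠ k in atTop, ∃ ℓ₀ : ℕ, 1 ≤ ℓ₀ ∧ ℓ₀ ≤ reg.L k ∧ (ℓ₀ : ℝ) * reg.a k ≤ K₀ * (1 + |Real.log (reg.a k)|) ∧ ∀ S : ℕ, reg.L k ≤ S → ∀ (f : Fin Nf) (v : Literature.Probability.LatticeModels.Site 4), v ∈ box 4 S → ‖v‖ = (ℓ₀ : ℝ) → (ℓ₀ : ℝ) ^ q * (1 + |reg.β k|) ^ q * ((∫ U : GaugeConfig 4 (2 * S + 1) (Matrix.specialUnitaryGroup (Fin 3) ℂ), ‖(diracMatrix U fun fl => reg.mcrit k + reg.a k * m fl / reg.Zm k).det‖ * (∑ a : Fin 3, ∑ i : Fin 4, ∑ b : Fin 3, ∑ j : Fin 4, ‖(diracMatrix U fun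 fl => reg.mcrit k + reg.a k * m fl / reg.Zm k)⁻¹ (quarkEquiv (f, (Torus.proj (2 * S + 1) 0, a, i))) (quarkEquiv (f, (Torus.proj (2 * S + 1) (v), b, j)))‖) ^ s ∂(wilsonMeasure (fundamentalRep (Fin 3)) (reg.β k))) / (∫ U : GaugeConfig 4 (2 * S + 1) (Matrix.specialUnitaryGroup (Fin 3) ℂ), ‖(diracMatrix U fun fl => reg.mcrit k + reg.a k * m fl / reg.Zm k).det‖ ∂(wilsonMeasure (fundamentalRep (Fin 3)) (reg.β k)))) ≤ 1) → ∀ K : ℝ, ∃ s δ C : ℝ, 0 < s ∧ s < 1 ∧ 0 < δ ∧ ∀ᶠ k in atTop, ∀ S : ℕ, reg.L k ≤ S → ∀ (f : Fin Nf) (v : Literature.Probability.LatticeModels.Site 4), v ∈ box 4 S → reg.a k * ‖v‖ ≤ K * (1 + |Real.log (reg.a k)|) → (∫ U : GaugeConfig 4 (2 * S + 1) (Matrix.specialUnitaryGroup (Fin 3) ℂ), ‖(diracMatrix U fun fl => reg.mcrit k + reg.a k * m fl / reg.Zm k).det‖ * (∑ a : Fin 3, ∑ i : Fin 4, ∑ b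 : Fin 3, ∑ j : Fin 4, ‖(diracMatrix U fun fl => reg.mcrit k + reg.a k * m fl / reg.Zm k)⁻¹ (quarkEquiv (f, (Torus.proj (2 * S + 1) 0, a, i))) (quarkEquiv (f, (Torus.proj (2 * S + 1) (v), b, j)))‖) ^ s ∂(wilsonMeasure (fundamentalRep (Fin 3)) (reg.β k))) / (∫ U : GaugeConfig 4 (2 * S + 1) (Matrix.specialUnitaryGroup (Fin 3) ℂ), ‖(diracMatrix U fun fl => reg.mcrit k + reg.a k * m fl / reg.Zm k).det‖ ∂(wilsonMeasure (fundamentalRep (Fin 3)) (reg.β k))) ≤ C * Real.exp (-(δ * (reg.a k * ‖v‖)))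

def UnitShellSign : Prop :=
  open MeasureTheory Filter Literature.MathematicalPhysics.QuantumFieldTheory Literature.MathematicalPhysics.QuantumLattice Literature.Probability.LatticeModels in ∀ Nf : ℕ, ∃ β₀ : ℝ, 0 < β₀ ∧ ∃ S₀ : ℕ, ∀ β : ℝ, |β| ≤ β₀ → ∀ (mq : Fin Nf → ℝ) (f : Fin Nf), -(81 / 10 : ℝ) ≤ mq f → mq f ≤ 1 / 10 → ∀ S : ℕ, S₀ ≤ S → ∀ s : ℝ, 0 < s → s < 1 → ∃ v : Literature.Probability.LatticeModels.Site 4, v ∈ box 4 S ∧ ‖v‖ = (1 : ℝ) ∧ 1 < (∫ U : GaugeConfig 4 (2 * S + 1) (Matrix.specialUnitaryGroup (Fin 3) ℂ), ‖(diracMatrix U mq).det‖ * (∑ a : Fin 3, ∑ i : Fin 4, ∑ b : Fin 3, ∑ j : Fin 4, ‖(diracMatrix U mq)⁻¹ (quarkEquiv (f, (Torus.proj (2 * S + 1) 0, a, i))) (quarkEquiv (f, (Torus.proj (2 * S + 1) (v), b, j)))‖) ^ s ∂(wilsonMeasure (fundamentalRep (Fin 3)) β)) / (∫ U : GaugeConfig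 4 (2 * S + 1) (Matrix.specialUnitaryGroup (Fin 3) ℂ), ‖(diracMatrix U mq).det‖ ∂(wilsonMeasure (fundamentalRep (Fin 3)) β))


open Summit.QuantumFields.QCD.Theorems.VonMisesCircles Summit.QuantumFields.QCD.Theorems.VonMisesCirclesC1
  Summit.QuantumFields.QCD.Theorems.VonMisesCirclesC2 Summit.QuantumFields.QCD.Theorems.VonMisesCirclesC3
open Literature.MathematicalPhysics.QuantumFieldTheory Literature.MathematicalPhysics.QuantumLattice
  Literature.Probability.LatticeModels

example : TwoStarPackage ↔ ∀ Nf : ℕ, TwoStarBounds Nf := Iff.rfl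
example : FarCollarStability ↔ ∀ Nf : ℕ, FarStability Nf := Iff.rfl
example : UnitShellSign ↔ ∀ Nf : ℕ, UnitShellLowerBound Nf := Iff.rfl
example : InwardCore ↔ (∀ (Nf : ℕ) (reg : QCDRegularisation Nf) (m : Fin Nf → ℝ), (∀ f, 0 < m f) → Input Nf reg m →
    ∀ K : ℝ, ∃ s δ C : ℝ, 0 < s ∧ s < 1 ∧ 0 < δ ∧ ∀ᶠ k in atTop, ∀ S : ℕ, reg.L k ≤ S →
      ∀ (f : Fin Nf) (v : Literature.Probability.LatticeModels.Site 4), v ∈ box 4 S →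
        reg.a k * ‖v‖ ≤ K * (1 + |Real.log (reg.a k)|) →
          cruxMoment Nf (reg.β k) (bareMass reg m k) S f v s ≤ C * Real.exp (-(δ * (reg.a k * ‖v‖)))) := Iff.rfl

/-- the glue in the shape the route's generated glue item will have -/
theorem glue_shape (h : (∀ Nf : ℕ, TwoStarBounds Nf) → (∀ Nf : ℕ, FarStability Nf) →
    (∀ (Nf : ℕ) (reg : QCDRegularisation Nf) (m : Fin Nf → ℝ), (∀ f, 0 < m f) → Input Nf reg m →
    ∀ K : ℝ, ∃ s δ C : ℝ, 0 < s ∧ s < 1 ∧ 0 < δ ∧ ∀ᶠ k in atTop, ∀ S : ℕ, reg.L k ≤ S →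
      ∀ (f : Fin Nf) (v : Literature.Probability.LatticeModels.Site 4), v ∈ box 4 S →
        reg.a k * ‖v‖ ≤ K * (1 + |Real.log (reg.a k)|) →
          cruxMoment Nf (reg.β k) (bareMass reg m k) S f v s ≤ C * Real.exp (-(δ * (reg.a k * ‖v‖)))) →
    (∀ Nf : ℕ, UnitShellLowerBound Nf) → Summit.QuantumFields.QCD.Theses.PauliWegnerSea.FMClosureUnquenched) :
    TwoStarPackage → FarCollarStability → InwardCore → UnitShellSign →
      Summit.QuantumFields.QCD.Theses.PauliWegnerSea.FMClosureUnquenched :=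
  fun h₁ h₂ h₃ h₄ => h h₁ h₂ h₃ h₄

end SplitScratchDefeq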